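import Mathlib
import HarnessLib

/-!
# Two counting lemmas for the LOCAL upper growth at the strict place (brick (1c-α/β) of the growth road to stub TS1,
# crux ♭T′ stmt-BirchSwinnertonDyer-26975, line `sigmacongruence`)

Route `UniversalToricDescent`, lead prover `bsd-wall-utd-p1` g15. THEOREMS ONLY (pure algebra); `--supports stmt-BirchSwinnertonDyer-26975`.
BSD is not proved by any of this.

For the target `P′ = ⊕_{w∣𝔭′} H¹(K_{∞,w}, E′[3^∞])` of the strict-place localisation one needs `#P′^{Γ_n}[3^k] ≤ 3^{2k·3^n}·C`
(memo GROWTH-ROAD-utdp1g15 §5 (1c)). The Galois-cohomological inputs are the Kummer surjection `ι_k : H¹(K_{∞,w}, E′[3^k]) ↠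
H¹(K_{∞,w}, E′[3^∞])[3^k]` (finite kernel `E′(K_{∞,w})[3^∞]/3^k`) and inflation–restriction; the two abstract counting steps are:
* `natCard_comap_le` — `#f⁻¹(S) ≤ #S · #ker f` for an additive homomorphism `f` (and `f⁻¹(S)` is finite when `S`, `ker f` are);
* `natCard_torsion_fixed_le` — if `ι : H → P` intertwines `T_H`, `T_P` (think `T = γ − 1`) and every `n`-torsion element of `P` is in
  the image of `ι`, then `#{x ∈ P | n x = 0 ∧ T_P x = 0} ≤ #ker ι · #ker T_H`: a preimage `h` of a `T_P`-fixed `x` has `T_H h ∈ ker ι`.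

References: [GreenbergVatsal2000] §2 (p. 25, the local terms at `p`); [GreenbergLNM1716] §3 Lemma 3.2.
-/

set_option autoImplicit false
-- the Theorems namespace of this sub repeats the summit name by design (D-0017 nested layout)
set_option linter.dupNamespace false

namespace Summit.BirchSwinnertonDyer.BirchSwinnertonDyer.Theorems.UniversalToricDescentInvariantTorsionBound

variable {X Y : Type*} [AddCommGroup X] [AddCommGroup Y]

/-- **`f⁻¹(S)` is finite and `#f⁻¹(S) ≤ #S · #ker f`** for an additive homomorphism `f : X → Y` with `S` and `ker f` finite
(`f⁻¹(S)/ (ker f) ↪ S`). [folklore] -/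
theorem finite_comap_and_natCard_comap_le (f : X →+ Y) (S : AddSubgroup Y) [Finite S] [Finite f.ker] :
    Finite (S.comap f) ∧ Nat.card (S.comap f) ≤ Nat.card S * Nat.card f.ker := by
  classical
  -- the restriction `g : f⁻¹(S) → S`
  let g : S.comap f →+ S := (f.comp (S.comap f).subtype).codRestrict S fun x ↦ x.2
  have hker : Nat.card g.ker ≤ Nat.card f.ker := by
    refine Nat.card_le_card_of_injective (fun x ↦ ⟨(x.1 : X), ?_⟩) ?_
    · have hx := x.2
      rw [AddMonoidHom.mem_ker] at hx ⊢
      exact congrArg Subtype.val hx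
    · intro a b hab
      apply Subtype.ext; apply Subtype.ext
      exact congrArg (fun z : f.ker ↦ (z : X)) hab
  haveI : Finite g.ker := Finite.of_injective (fun x : g.ker ↦ (⟨(x.1 : X), by
      have hx := x.2; rw [AddMonoidHom.mem_ker] at hx ⊢; exact congrArg Subtype.val hx⟩ : f.ker))
    (fun a b hab ↦ by apply Subtype.ext; apply Subtype.ext; exact congrArg (fun z : f.ker ↦ (z : X)) hab)
  haveI : Finite g.range := Finite.of_injective _ Subtype.val_injective
  -- `f⁻¹(S) / ker g ≃ range g`
  have hfin : Finite (S.comap f) := by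
    have e := QuotientAddGroup.quotientKerEquivRange g
    haveI : Finite (S.comap f ⧸ g.ker) := Finite.of_equiv _ e.toEquiv.symm
    exact Finite.of_addSubgroup_quotient g.ker
  refine ⟨hfin, ?_⟩
  haveI := hfin
  rw [AddSubgroup.card_eq_card_quotient_mul_card_addSubgroup g.ker,
    Nat.card_congr (QuotientAddGroup.quotientKerEquivRange g).toEquiv]
  exact Nat.mul_le_mul (Nat.card_le_card_of_injective _ Subtype.val_injective) hker


/-- `#f⁻¹(S) ≤ #S · #ker f`. [folklore] -/
theorem natCard_comap_le (f : X →+ Y) (S : AddSubgroup Y) [Finite S] [Finite f.ker] :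
    Nat.card (S.comap f) ≤ Nat.card S * Nat.card f.ker :=
  (finite_comap_and_natCard_comap_le f S).2

variable {H P : Type*} [AddCommGroup H] [AddCommGroup P]

/-- **`#{x ∈ P | n x = 0 ∧ T_P x = 0} ≤ #ker ι · #ker T_H`** when `ι : H → P` intertwines `T_H, T_P` and every `n`-torsion element
of `P` lies in the image of `ι` (e.g. `ι` = the Kummer map `H¹(L, A[n]) → H¹(L, A)`, onto `H¹(L, A)[n]`, `T = γ − 1`): choosing a
preimage `h` of each such `x`, `ι(T_H h) = T_P x = 0`, so `h ∈ T_H⁻¹(ker ι)`, a set of size `≤ #ker ι · #ker T_H`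
(`natCard_comap_le`), and `x ↦ h` is injective. [cite: GreenbergLNM1716, §3 Lemma 3.2 (p. 86)] -/
theorem natCard_torsion_fixed_le (ι : H →+ P) (TH : H →+ H) (TP : P →+ P) (hcomm : ∀ h, ι (TH h) = TP (ι h)) (n : ℕ)
    (hsurj : ∀ x : P, n • x = 0 → ∃ h, ι h = x) [Finite ι.ker] [Finite TH.ker] :
    Finite {x : P // n • x = 0 ∧ TP x = 0} ∧
      Nat.card {x : P // n • x = 0 ∧ TP x = 0} ≤ Nat.card ι.ker * Nat.card TH.ker := by
  classical
  obtain ⟨hfin, hle⟩ := finite_comap_and_natCard_comap_le TH ι.ker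
  haveI := hfin
  -- choose preimages
  have key : ∀ x : {x : P // n • x = 0 ∧ TP x = 0}, ∃ h : ι.ker.comap TH, ι (h : H) = x := by
    rintro ⟨x, hxn, hxT⟩
    obtain ⟨h, rfl⟩ := hsurj x hxn
    refine ⟨⟨h, ?_⟩, rfl⟩
    rw [AddSubgroup.mem_comap, AddMonoidHom.mem_ker, hcomm, hxT]
  choose lift hlift using key
  have hinj : Function.Injective lift := fun a b hab ↦ by
    apply Subtype.ext
    rw [← hlift a, ← hlift b, hab]
  exact ⟨Finite.of_injective lift hinj, (Nat.card_le_card_of_injective lift hinj).trans hle⟩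

/-- **Invariants of a quotient-like image: `#{y ∈ P | T_P y = 0} ≤ #H_T · #C`** for `ι : H → P` SURJECTIVE intertwining `T_H, T_P`,
where `H_T = ker T_H` and `C ⊇` the defect `{h | T_H h ∈ ker ι} / …` is controlled by `#ker ι`-many cosets — the form used for
inflation–restriction `H¹(K_{n,w}, ·) ↠ H¹(K_{∞,w}, ·)^{Γ_{n,w}}` is the special case `n = 0` of `natCard_torsion_fixed_le`:
`#{x | T_P x = 0} ≤ #ker ι · #ker T_H`. [cite: GreenbergLNM1716, §3 Lemma 3.2 (p. 86)] -/
theorem natCard_fixed_le_of_surjective (ι : H →+ P) (TH : H →+ H) (TP : P →+ P) (hcomm : ∀ h, ι (TH h) = TP (ι h))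
    (hsurj : Function.Surjective ι) [Finite ι.ker] [Finite TH.ker] :
    Finite TP.ker ∧ Nat.card TP.ker ≤ Nat.card ι.ker * Nat.card TH.ker := by
  obtain ⟨hfin, hle⟩ := natCard_torsion_fixed_le ι TH TP hcomm 0 (fun x _ ↦ hsurj x)
  let e : TP.ker ≃ {x : P // 0 • x = 0 ∧ TP x = 0} :=
    { toFun := fun x ↦ ⟨x.1, by rw [zero_smul], x.2⟩
      invFun := fun x ↦ ⟨x.1, x.2.2⟩
      left_inv := fun _ ↦ rfl
      right_inv := fun _ ↦ rfl }
  haveI := hfin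
  exact ⟨Finite.of_equiv _ e.symm, (Nat.card_congr e).trans_le hle⟩


/-- **Inflation–restriction form: `#{x ∈ B_H | n x = 0 ∧ T x = 0} ≤ #ker(res) · #B_G[n]`** when every `T`-fixed element of
`B_H` is a restriction (`res : B_G → B_H`, e.g. `H¹(G, A) → H¹(H, A)^{γ}` onto by procyclic descent, X11b
`ProcyclicDescent.exists_resSubgroup_eq_of_conjH1_eq`) and `ker(res)` (inflation of `H¹(G/H, A^H)`) is finite: a preimage `z` of
such an `x` has `n z ∈ ker(res)`, i.e. `z ∈ (·n)⁻¹(ker res)`, a set of size `≤ #ker(res) · #B_G[n]` (`natCard_comap_le`).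
[cite: GreenbergLNM1716, §3 Lemma 3.2 (p. 86)] [cite: GreenbergVatsal2000, §2 p. 25] -/
theorem natCard_torsion_fixed_le_of_res (res : H →+ P) (TP : P →+ P) (n : ℕ)
    (hsurj : ∀ x : P, TP x = 0 → ∃ z, res z = x) [Finite res.ker] [Finite (nsmulAddMonoidHom (α := H) n).ker] :
    Finite {x : P // n • x = 0 ∧ TP x = 0} ∧
      Nat.card {x : P // n • x = 0 ∧ TP x = 0} ≤ Nat.card res.ker * Nat.card (nsmulAddMonoidHom (α := H) n).ker := by
  classical
  obtain ⟨hfin, hle⟩ := finite_comap_and_natCard_comap_le (nsmulAddMonoidHom (α := H) n) res.ker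
  haveI := hfin
  have key : ∀ x : {x : P // n • x = 0 ∧ TP x = 0}, ∃ z : res.ker.comap (nsmulAddMonoidHom (α := H) n), res (z : H) = x := by
    rintro ⟨x, hxn, hxT⟩
    obtain ⟨z, rfl⟩ := hsurj x hxT
    refine ⟨⟨z, ?_⟩, rfl⟩
    rw [AddSubgroup.mem_comap, AddMonoidHom.mem_ker, nsmulAddMonoidHom_apply, map_nsmul, hxn]
  choose lift hlift using key
  have hinj : Function.Injective lift := fun a b hab ↦ by
    apply Subtype.ext
    rw [← hlift a, ← hlift b, hab]
  exact ⟨Finite.of_injective lift hinj, (Nat.card_le_card_of_injective lift hinj).trans hle⟩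

end Summit.BirchSwinnertonDyer.BirchSwinnertonDyer.Theorems.UniversalToricDescentInvariantTorsionBound
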